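import Mathlib
import Summits.ValiantsHypothesis.ValiantsHypothesis.Theorems.BarrierLeverPartitionMinorsHitByVPHiddenStatesPathTableStaircase
import Summits.ValiantsHypothesis.ValiantsHypothesis.Theorems.BarrierLeverPartitionMinorsHitByVPHiddenStatesPathTableTransfer
import Summits.ValiantsHypothesis.ValiantsHypothesis.Theorems.BarrierLeverPartitionMinorsHitByVPHiddenStatesPathTablePeel

/-!
# Route BarrierLever — item `PartitionMinorsHitByVP` (stmt-ValiantsHypothesis-19717), line `hidden-states`:
# THE PATH TABLE OF `P_k` — definitions, unipotence, and the local identity of its staircase functional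

Helper file (`--supports stmt-ValiantsHypothesis-19717`; cell valiant-natproofs, 𝒟-side door (c), registered line
`Cruxes/PartitionMinorsHitByVP/Lines/hidden_states.lean` v8; prover seat val-np-p6 gen 16).  Closes NO item.  Definitions: the level map
`lvlX` (`0, 0, 1, …, k−2`), the PATH TABLE `pw k s` on the index type `Fin (k+1) ⊕ Fin k` (Y = `inl`, X = `inr`):
`y_{inl a} = χ_{inl a} + s·χ_{inl (a−1)} + Σ_{lvlX i = a} χ_{inr i}`, `y_{inr i} = χ_{inr i}` (memo HOME/val-np-p6/g16/MEMO-valnp6-g16.md §1),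
its potential `ppot`, and the staircase functional `zk k s` of a set `R` = `zetaLA s (levels of the missing X-elements) (values of the
Y-elements)` (guarded: zero unless the level map is injective on the missing X-elements).
* `pw_self`, `pw_ne_zero` — the table is UNIPOTENT for `ppot` (hypotheses of `…PathTableTransfer.det_ne_zero_of_dual`).
* `zk_card_ne` — `zk` is supported on `k`-sets.
* ★ `zk_local` — the local identity (L<) in table form: for `|R| = k − 1` whose Y-elements are all below `a`,
  `Σ_q pw (inl a) q · zk (R + q) = 0` (from `zetaLA_local`).

WHAT THIS IS NOT: Theorems A/B of the memo (annihilation of the rows, the value on `Y`) and the determinant are in the sequel; nothing on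
crux 14610 or VP ≠ VNP.
-/

set_option linter.dupNamespace false

namespace Summit.ValiantsHypothesis.ValiantsHypothesis.Theorems.BarrierLever.HiddenStates

open Finset

noncomputable section

namespace PathTable

/-! ## Definitions -/

/-- the LEVEL of the X-element `i`: `lvlX 0 = lvlX 1 = 0`, `lvlX i = i − 1`. -/
def lvlX (k : ℕ) (i : Fin k) : ℕ := (i : ℕ) - 1

/-- **The path table of `P_k`**: `pw k s a q` = the coefficient of `[q ∈ J]` in coordinate `a` of the hidden point of `J`. -/
def pw (k : ℕ) (s : ℂ) : Fin (k + 1) ⊕ Fin k → Fin (k + 1) ⊕ Fin k → ℂ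
  | Sum.inr i, q => if q = Sum.inr i then 1 else 0
  | Sum.inl a, Sum.inl b => if b = a then 1 else if (b : ℕ) + 1 = (a : ℕ) then s else 0
  | Sum.inl a, Sum.inr i => if lvlX k i = (a : ℕ) then 1 else 0

/-- the potential: `inl a ↦ a + 1`, `inr i ↦ 0`. -/
def ppot (k : ℕ) : Fin (k + 1) ⊕ Fin k → ℕ
  | Sum.inl a => (a : ℕ) + 1
  | Sum.inr _ => 0

/-- the levels of the X-elements MISSING from `R`. -/
def Lset (k : ℕ) (R : Finset (Fin (k + 1) ⊕ Fin k)) : Finset ℕ :=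
  ((Finset.univ : Finset (Fin k)) \ R.toRight).image (lvlX k)

/-- the values of the Y-elements of `R`. -/
def Aset (k : ℕ) (R : Finset (Fin (k + 1) ⊕ Fin k)) : Finset ℕ :=
  R.toLeft.image (fun a : Fin (k + 1) => (a : ℕ))

/-- **the staircase functional of the path table** (guarded by `|R| = k` and injectivity of the level map on the missing
X-elements, i.e. not both level-0 elements missing). -/
def zk (k : ℕ) (s : ℂ) (R : Finset (Fin (k + 1) ⊕ Fin k)) : ℂ :=
  if R.card = k ∧ ((Finset.univ : Finset (Fin k)) \ R.toRight).card = (Lset k R).card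
  then zetaLA s (Lset k R) (Aset k R) else 0

variable {k : ℕ} {s : ℂ}

/-! ## Unipotence -/

/-- diagonal weights are `1`. -/
theorem pw_self (k : ℕ) (s : ℂ) (a : Fin (k + 1) ⊕ Fin k) : pw k s a a = 1 := by
  rcases a with a | i <;> simp [pw]

/-- every off-diagonal source is strictly lower in potential. -/
theorem pw_ne_zero (k : ℕ) (s : ℂ) (a q : Fin (k + 1) ⊕ Fin k) (h : pw k s a q ≠ 0) :
    q = a ∨ ppot k q < ppot k a := by
  rcases a with a | i
  · rcases q with b | j
    · simp only [pw] at h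
      by_cases hba : b = a
      · exact Or.inl (by rw [hba])
      · rw [if_neg hba] at h
        by_cases hb1 : (b : ℕ) + 1 = (a : ℕ)
        · right; simp only [ppot]; omega
        · rw [if_neg hb1] at h; exact (h rfl).elim
    · right; simp [ppot]
  · simp only [pw] at h
    by_cases hq : q = Sum.inr i
    · exact Or.inl hq
    · rw [if_neg hq] at h; exact (h rfl).elim

/-! ## Basic facts on `Lset`, `Aset`, `zk` -/

/-- `Aset` has the cardinality of the Y-part. -/
theorem card_Aset (R : Finset (Fin (k + 1) ⊕ Fin k)) : (Aset k R).card = R.toLeft.card :=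
  Finset.card_image_of_injective _ Fin.val_injective

/-- membership in `Aset`. -/
theorem mem_Aset {R : Finset (Fin (k + 1) ⊕ Fin k)} {x : ℕ} :
    x ∈ Aset k R ↔ ∃ b : Fin (k + 1), Sum.inl b ∈ R ∧ (b : ℕ) = x := by
  simp [Aset]

/-- `zk` is supported on `k`-sets. -/
theorem zk_card_ne {R : Finset (Fin (k + 1) ⊕ Fin k)} (h : R.card ≠ k) : zk k s R = 0 := by
  simp [zk, h]

/-- the guard: cardinalities of `Lset` and `Aset` when the level map is injective on the missing X-elements. -/
theorem card_Lset_of_injOn {R : Finset (Fin (k + 1) ⊕ Fin k)}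
    (hg : ((Finset.univ : Finset (Fin k)) \ R.toRight).card = (Lset k R).card) :
    (Lset k R).card + R.toRight.card = k := by
  rw [← hg, Finset.card_sdiff_of_subset (Finset.subset_univ _), Finset.card_univ, Fintype.card_fin]
  have := Finset.card_le_univ R.toRight
  rw [Fintype.card_fin] at this
  omega

/-- two distinct X-elements of equal level are the two level-0 elements. -/
theorem lvlX_eq_iff_of_ne {i j : Fin k} (hne : i ≠ j) (h : lvlX k i = lvlX k j) : (i : ℕ) ≤ 1 ∧ (j : ℕ) ≤ 1 := by
  simp only [lvlX] at h
  have : (i : ℕ) ≠ (j : ℕ) := fun e => hne (Fin.ext e)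
  omega

/-- the guard holds iff the level map is injective on the missing X-elements. -/
theorem guard_iff (R : Finset (Fin (k + 1) ⊕ Fin k)) :
    ((Finset.univ : Finset (Fin k)) \ R.toRight).card = (Lset k R).card ↔
      Set.InjOn (lvlX k) ↑((Finset.univ : Finset (Fin k)) \ R.toRight) := by
  unfold Lset
  constructor
  · intro h; exact Finset.injOn_of_card_image_eq h.symm
  · intro h; exact (Finset.card_image_of_injOn h).symm

/-! ## Insertion lemmas -/

/-- inserting a Y-element: `zk (R + inl b) = ζ(L(R), A(R) + b)` for `|R| = k − 1` under the guard. -/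
theorem zk_insert_inl {R : Finset (Fin (k + 1) ⊕ Fin k)} (hR : R.card + 1 = k)
    (hg : ((Finset.univ : Finset (Fin k)) \ R.toRight).card = (Lset k R).card) (b : Fin (k + 1)) :
    zk k s (insert (Sum.inl b) R) = zetaLA s (Lset k R) (insert (b : ℕ) (Aset k R)) := by
  have hLA : (Lset k R).card = (Aset k R).card + 1 := by
    have h1 := card_Lset_of_injOn hg
    have h2 := Finset.card_toLeft_add_card_toRight (u := R)
    rw [card_Aset]; omega
  by_cases hb : Sum.inl b ∈ R
  · rw [Finset.insert_eq_of_mem hb, zk_card_ne (by omega)]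
    have : (b : ℕ) ∈ Aset k R := mem_Aset.2 ⟨b, hb, rfl⟩
    rw [Finset.insert_eq_of_mem this, zetaLA_of_card_ne (by omega)]
  · have hL : Lset k (insert (Sum.inl b) R) = Lset k R := by simp [Lset]
    have hA : Aset k (insert (Sum.inl b) R) = insert (b : ℕ) (Aset k R) := by simp [Aset, Finset.image_insert]
    have hg' : ((Finset.univ : Finset (Fin k)) \ (insert (Sum.inl b) R).toRight).card = (Lset k (insert (Sum.inl b) R)).card := by
      rw [hL, Finset.toRight_insert_inl]; exact hg
    simp only [zk, Finset.card_insert_of_notMem hb, hR, hg', true_and, if_true, hL, hA]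

/-- inserting X-elements of level `b`, summed: `Σ_{lvlX i = b} zk (R + inr i) = ζ(L(R) − b, A(R))` for `|R| = k − 1` under the guard. -/
theorem sum_zk_insert_inr {R : Finset (Fin (k + 1) ⊕ Fin k)} (hR : R.card + 1 = k)
    (hg : ((Finset.univ : Finset (Fin k)) \ R.toRight).card = (Lset k R).card) (b : ℕ) :
    ∑ i ∈ Finset.univ.filter (fun i : Fin k => lvlX k i = b), zk k s (insert (Sum.inr i) R) =
      zetaLA s ((Lset k R).erase b) (Aset k R) := by
  have hinj := (guard_iff R).1 hg
  have hLA : (Lset k R).card = (Aset k R).card + 1 := by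
    have h1 := card_Lset_of_injOn hg
    have h2 := Finset.card_toLeft_add_card_toRight (u := R)
    rw [card_Aset]; omega
  -- terms with `inr i ∈ R` vanish
  have hzero : ∀ i : Fin k, Sum.inr i ∈ R → zk k s (insert (Sum.inr i) R) = 0 := fun i hi => by
    rw [Finset.insert_eq_of_mem hi]; exact zk_card_ne (by omega)
  by_cases hex : ∃ i₀ : Fin k, Sum.inr i₀ ∉ R ∧ lvlX k i₀ = b
  · obtain ⟨i₀, hi₀, hli₀⟩ := hex
    have hmiss : i₀ ∈ (Finset.univ : Finset (Fin k)) \ R.toRight := by simp [hi₀]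
    rw [Finset.sum_eq_single i₀]
    · -- the main term
      have hcard : (insert (Sum.inr i₀) R).card = k := by rw [Finset.card_insert_of_notMem hi₀]; exact hR
      have hmiss' : (Finset.univ : Finset (Fin k)) \ (insert (Sum.inr i₀) R).toRight =
          ((Finset.univ : Finset (Fin k)) \ R.toRight).erase i₀ := by
        ext j; simp [Finset.mem_sdiff, Finset.mem_erase]
      have hL : Lset k (insert (Sum.inr i₀) R) = (Lset k R).erase b := by
        unfold Lset
        rw [hmiss']
        ext x
        simp only [Finset.mem_image, Finset.mem_erase]
        constructor
        · rintro ⟨j, ⟨hj0, hj⟩, rfl⟩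
          refine ⟨fun h => hj0 (hinj (Finset.mem_coe.2 hj) (Finset.mem_coe.2 hmiss) (h.trans hli₀.symm)), j, hj, rfl⟩
        · rintro ⟨hx, j, hj, rfl⟩
          exact ⟨j, ⟨fun h => hx (by rw [h, hli₀]), hj⟩, rfl⟩
      have hA : Aset k (insert (Sum.inr i₀) R) = Aset k R := by simp [Aset]
      have hg' : ((Finset.univ : Finset (Fin k)) \ (insert (Sum.inr i₀) R).toRight).card =
          (Lset k (insert (Sum.inr i₀) R)).card := by
        rw [guard_iff, hmiss']
        exact hinj.mono (by intro j hj; exact (Finset.mem_erase.1 hj).2)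
      simp only [zk, hcard, hg', true_and, if_true, hL, hA]
    · intro i hi hne
      by_cases hiR : Sum.inr i ∈ R
      · exact hzero i hiR
      · exfalso; apply hne
        have hli := (Finset.mem_filter.1 hi).2
        exact hinj (by simp [hiR]) (Finset.mem_coe.2 hmiss) (hli.trans hli₀.symm)
    · intro h
      exact (h (Finset.mem_filter.2 ⟨Finset.mem_univ _, hli₀⟩)).elim
  · -- no missing element of level `b`: everything vanishes
    push Not at hex
    have hb : b ∉ Lset k R := by
      unfold Lset
      rintro h
      obtain ⟨j, hj, hjb⟩ := Finset.mem_image.1 h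
      exact hex j (by simpa using hj) hjb
    rw [Finset.erase_eq_of_notMem hb, zetaLA_of_card_ne (by omega)]
    refine Finset.sum_eq_zero fun i hi => hzero i ?_
    by_contra hiR
    exact hex i hiR (Finset.mem_filter.1 hi).2

/-! ## The local identity in table form -/

/-- ★ **(L<) for the path table**: for `|R| = k − 1` whose Y-elements are all below `a`,
`Σ_q pw (inl a) q · zk (R + q) = 0`. -/
theorem zk_local {R : Finset (Fin (k + 1) ⊕ Fin k)} (hR : R.card + 1 = k) (a : Fin (k + 1))
    (hA : ∀ b : Fin (k + 1), Sum.inl b ∈ R → b < a) :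
    ∑ q : Fin (k + 1) ⊕ Fin k, pw k s (Sum.inl a) q * zk k s (insert q R) = 0 := by
  classical
  rw [Fintype.sum_sum_type]
  -- the X-part of the sum: only sources of level `a`
  have hX : ∑ i : Fin k, pw k s (Sum.inl a) (Sum.inr i) * zk k s (insert (Sum.inr i) R) =
      ∑ i ∈ Finset.univ.filter (fun i : Fin k => lvlX k i = (a : ℕ)), zk k s (insert (Sum.inr i) R) := by
    rw [Finset.sum_filter]
    refine Finset.sum_congr rfl fun i _ => ?_
    simp only [pw]
    split_ifs <;> simp
  -- the Y-part: the sources `inl a` and `inl (a − 1)`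
  have hY : ∑ b : Fin (k + 1), pw k s (Sum.inl a) (Sum.inl b) * zk k s (insert (Sum.inl b) R) =
      zk k s (insert (Sum.inl a) R) +
        (if 1 ≤ (a : ℕ) then s * ∑ b ∈ Finset.univ.filter (fun b : Fin (k + 1) => (b : ℕ) + 1 = (a : ℕ)),
          zk k s (insert (Sum.inl b) R) else 0) := by
    have hsplit : ∀ b : Fin (k + 1), pw k s (Sum.inl a) (Sum.inl b) * zk k s (insert (Sum.inl b) R) =
        (if b = a then zk k s (insert (Sum.inl b) R) else 0) +
          (if (b : ℕ) + 1 = (a : ℕ) then s * zk k s (insert (Sum.inl b) R) else 0) := by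
      intro b
      simp only [pw]
      by_cases h1 : b = a
      · subst h1; simp
      · rw [if_neg h1, if_neg h1]
        split_ifs <;> simp
    simp only [hsplit, Finset.sum_add_distrib, Finset.sum_ite_eq', Finset.mem_univ, if_true]
    congr 1
    rw [← Finset.sum_filter, ← Finset.mul_sum]
    split_ifs with ha
    · rfl
    · have : Finset.univ.filter (fun b : Fin (k + 1) => (b : ℕ) + 1 = (a : ℕ)) = ∅ := by
        ext b; simp; omega
      rw [this, Finset.sum_empty, mul_zero]
  rw [hX, hY]
  -- the guard: is the level map injective on the missing X-elements?
  by_cases hg : ((Finset.univ : Finset (Fin k)) \ R.toRight).card = (Lset k R).card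
  · -- translate the three groups
    have h1 : zk k s (insert (Sum.inl a) R) = zetaLA s (Lset k R) (insert (a : ℕ) (Aset k R)) :=
      zk_insert_inl hR hg a
    have h2 : (if 1 ≤ (a : ℕ) then s * ∑ b ∈ Finset.univ.filter (fun b : Fin (k + 1) => (b : ℕ) + 1 = (a : ℕ)),
          zk k s (insert (Sum.inl b) R) else 0) =
        (if 1 ≤ (a : ℕ) then s * zetaLA s (Lset k R) (insert ((a : ℕ) - 1) (Aset k R)) else 0) := by
      split_ifs with ha
      · have hset : Finset.univ.filter (fun b : Fin (k + 1) => (b : ℕ) + 1 = (a : ℕ)) =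
            {(⟨(a : ℕ) - 1, by omega⟩ : Fin (k + 1))} := by
          ext b
          simp only [Finset.mem_filter, Finset.mem_univ, true_and, Finset.mem_singleton, Fin.ext_iff]
          omega
        rw [hset, Finset.sum_singleton, zk_insert_inl hR hg]
      · rfl
    have h3 := sum_zk_insert_inr (s := s) hR hg (a : ℕ)
    rw [h1, h2, h3]
    -- the hypotheses of `zetaLA_local`
    have hLA : (Lset k R).card = (Aset k R).card + 1 := by
      have c1 := card_Lset_of_injOn hg
      have c2 := Finset.card_toLeft_add_card_toRight (u := R)
      rw [card_Aset]; omega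
    have hAlt : ∀ x ∈ Aset k R, x < (a : ℕ) := by
      intro x hx
      obtain ⟨b, hb, rfl⟩ := mem_Aset.1 hx
      exact hA b hb
    exact zetaLA_local s hLA hAlt
  · -- guard fails: two distinct missing X-elements of level 0; then `a ≥ 1` and every term vanishes
    have hinj : ¬ Set.InjOn (lvlX k) ↑((Finset.univ : Finset (Fin k)) \ R.toRight) := fun h => hg ((guard_iff R).2 h)
    rw [Set.InjOn] at hinj
    push Not at hinj
    obtain ⟨i, hi, j, hj, hij, hne⟩ := hinj
    simp only [Finset.coe_sdiff, Set.mem_sdiff, Finset.mem_coe, Finset.mem_toRight] at hi hj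
    -- `R` has a Y-element (else only one X-element is missing), hence `a ≥ 1`
    have ha : 1 ≤ (a : ℕ) := by
      by_contra ha
      push Not at ha
      have hY0 : R.toLeft = ∅ := by
        rw [Finset.eq_empty_iff_forall_notMem]
        intro b hb
        have := hA b (Finset.mem_toLeft.1 hb)
        have : (b : ℕ) < (a : ℕ) := this
        omega
      have c2 := Finset.card_toLeft_add_card_toRight (u := R)
      rw [hY0, Finset.card_empty, zero_add] at c2
      -- two missing X-elements but `|R.toRight| = k − 1`
      have hsub : ({i, j} : Finset (Fin k)) ⊆ (Finset.univ : Finset (Fin k)) \ R.toRight := by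
        intro x hx
        rcases Finset.mem_insert.1 hx with rfl | hx
        · simp [hi.2]
        · rw [Finset.mem_singleton.1 hx]; simp [hj.2]
      have := Finset.card_le_card hsub
      rw [Finset.card_pair hne, Finset.card_sdiff_of_subset (Finset.subset_univ _), Finset.card_univ, Fintype.card_fin] at this
      omega
    -- every inserted set still misses two X-elements of equal level
    have hvan : ∀ q : Fin (k + 1) ⊕ Fin k, q ≠ Sum.inr i → q ≠ Sum.inr j → zk k s (insert q R) = 0 := by
      intro q hqi hqj
      simp only [zk]
      rw [if_neg]
      rintro ⟨-, hg'⟩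
      have hinj' := (guard_iff _).1 hg'
      have hi' : i ∈ ((Finset.univ : Finset (Fin k)) \ (insert q R).toRight) := by
        simp only [Finset.mem_sdiff, Finset.mem_univ, true_and, Finset.mem_toRight, Finset.mem_insert, not_or]
        exact ⟨fun h => hqi h.symm, hi.2⟩
      have hj' : j ∈ ((Finset.univ : Finset (Fin k)) \ (insert q R).toRight) := by
        simp only [Finset.mem_sdiff, Finset.mem_univ, true_and, Finset.mem_toRight, Finset.mem_insert, not_or]
        exact ⟨fun h => hqj h.symm, hj.2⟩
      exact hne (hinj' (Finset.mem_coe.2 hi') (Finset.mem_coe.2 hj') hij)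
    have hli : (i : ℕ) ≤ 1 ∧ (j : ℕ) ≤ 1 := lvlX_eq_iff_of_ne hne hij
    rw [hvan (Sum.inl a) (by simp) (by simp), if_pos ha]
    have hY2 : ∑ b ∈ Finset.univ.filter (fun b : Fin (k + 1) => (b : ℕ) + 1 = (a : ℕ)),
        zk k s (insert (Sum.inl b) R) = 0 :=
      Finset.sum_eq_zero fun b _ => hvan (Sum.inl b) (by simp) (by simp)
    have hX2 : ∑ i' ∈ Finset.univ.filter (fun i' : Fin k => lvlX k i' = (a : ℕ)), zk k s (insert (Sum.inr i') R) = 0 := by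
      refine Finset.sum_eq_zero fun i' hi' => hvan (Sum.inr i') ?_ ?_
      · intro h
        have := (Finset.mem_filter.1 hi').2
        rw [Sum.inr.inj h] at this
        simp only [lvlX] at this; omega
      · intro h
        have := (Finset.mem_filter.1 hi').2
        rw [Sum.inr.inj h] at this
        simp only [lvlX] at this; omega
    rw [hY2, hX2, mul_zero]
    ring

end PathTable

end

end Summit.ValiantsHypothesis.ValiantsHypothesis.Theorems.BarrierLever.HiddenStates
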